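import Summits.ValiantsHypothesis.ValiantsHypothesis.Theorems.PolyaContinuedSignedCoverLittleStubEven
import Summits.ValiantsHypothesis.ValiantsHypothesis.Theorems.PolyaContinuedSignedCoverLittleChain
import Summits.ValiantsHypothesis.ValiantsHypothesis.Theorems.PolyaContinuedSignedCoverLittleFold
import Summits.ValiantsHypothesis.ValiantsHypothesis.Theorems.PolyaContinuedSignedCoverLittleNoParallel
import Summits.ValiantsHypothesis.ValiantsHypothesis.Theorems.PolyaContinuedSignedCoverLittleTranspose
import Summits.ValiantsHypothesis.ValiantsHypothesis.Theorems.PolyaContinuedSignedCoverLittleBase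
import HarnessLib

/-!
# Route PolyaContinued — support item `SignedCoverLittle` (stmt-ValiantsHypothesis-7426): THE CLOSER

`SignedCoverLittle` (Pólya's problem at equal size in the cover model) holds: a perfect-matching
polynomial `PM_E` that is a projection of `PM_{E'}` for a Pfaffian `E'` of the same size is itself the
perfect-matching polynomial of a Pfaffian graph. Assembly of the 7426 port (lead p1; p2, p3, p4):
reduction to label transfer (`…Reduction`, 08-16 seat), the E-side chain (`labelIdentity_chain_of`, p1, with
the four section lemmas: fold `exists_fold` (p4, `…SameBoard`/`…Fold`), no-parallel
`not_parallel_of_deletionMinimal` (p2), transpose `labelIdentity_transpose'` (p2), base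
`exists_relabel_kstd_of_minimal` (p3, `…Base`, Little's theorem as a black box)) and the H-side
`signedCoverLittle_of_chain` (p2/p3/p4: normal form, five dicircuits, forks, two-circuit ear lemma,
even-coverage certificate — the paper proof `proof-LabelTransfer.md` of the 08-16 seat).
VP ≠ VNP is NOT proved by this file (support rung of route PolyaContinued).
-/

noncomputable section

namespace Summit.ValiantsHypothesis.PolyaContinued

open MvPolynomial Finset Literature.Combinatorics.SimpleGraph Equiv

/-- The fold spec of the driver, from p4's `exists_fold` (`…SignedCoverLittleFold.lean`). -/
theorem spec_fold {n : ℕ} : ∀ (E : Finset (Fin n × Fin n)) (a b₀ b₁ : Fin n), b₀ ≠ b₁ →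
      (∀ c, (a, c) ∈ E ↔ c = b₀ ∨ c = b₁) →
      (∀ r, r ≠ a → ¬ ((r, b₀) ∈ E ∧ (r, b₁) ∈ E)) →
      ∃ (E₂ : Finset (Fin n × Fin n)) (ψ : Fin n × Fin n → Fin n × Fin n),
        E₂.card < E.card ∧ (IsPfaffianBipartite E₂ ↔ IsPfaffianBipartite E) ∧
        ∀ (H : Finset (Fin n × Fin n)) (φ : Fin n × Fin n → Fin n × Fin n),
          (∑ σ : Perm (Fin n), if (∀ i, (i, σ i) ∈ H) then
              ∏ i, (X (φ (i, σ i)) : MvPolynomial (Fin n × Fin n) ℂ) else 0) =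
            perfectMatchingPoly E ℂ →
          (∑ σ : Perm (Fin n), if (∀ i, (i, σ i) ∈ H) then
              ∏ i, (X (ψ (φ (i, σ i))) : MvPolynomial (Fin n × Fin n) ℂ) else 0) =
            perfectMatchingPoly E₂ ℂ :=
  fun E a b₀ b₁ hb hrow hNP => exists_fold E a b₀ b₁ hb hrow hNP

/-- The no-parallel spec of the driver, from p2's `not_parallel_of_deletionMinimal`
(`…SignedCoverLittleNoParallel.lean`). -/
theorem spec_noParallel {n : ℕ} : ∀ (E : Finset (Fin n × Fin n)) (a b₀ b₁ : Fin n),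
      ¬ IsPfaffianBipartite E →
      (∀ e ∈ E, IsPfaffianBipartite (E.erase e)) → b₀ ≠ b₁ →
      (∀ c, (a, c) ∈ E ↔ c = b₀ ∨ c = b₁) →
      ∀ r, r ≠ a → ¬ ((r, b₀) ∈ E ∧ (r, b₁) ∈ E) :=
  fun _ _ _ _ hE hdel hb hrow _ hr h => not_parallel_of_deletionMinimal hE hdel hb hrow hr h.1 h.2

/-- The transpose spec of the driver, from p2's `labelIdentity_transpose'`
(`…SignedCoverLittleTranspose.lean`). -/
theorem spec_transpose {n : ℕ} : ∀ (H E : Finset (Fin n × Fin n)) (φ : Fin n × Fin n → Fin n × Fin n),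
      (∑ σ : Perm (Fin n), if (∀ i, (i, σ i) ∈ H) then
          ∏ i, (X (φ (i, σ i)) : MvPolynomial (Fin n × Fin n) ℂ) else 0) =
        perfectMatchingPoly E ℂ →
      (∑ σ : Perm (Fin n), if (∀ i, (i, σ i) ∈ H) then
          ∏ i, (X (Prod.swap (φ (i, σ i))) : MvPolynomial (Fin n × Fin n) ℂ) else 0) =
        perfectMatchingPoly (transposeEdges E) ℂ :=
  fun _ _ _ hid => labelIdentity_transpose' hid

/-- The base spec of the driver, from p3's `exists_relabel_kstd_of_minimal`
(`…SignedCoverLittleBase.lean`): a deletion-minimal non-Pfaffian target without a line of exactly two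
cells is a relabelled standard target. -/
theorem spec_base {n : ℕ} : ∀ (E : Finset (Fin n × Fin n)), ¬ IsPfaffianBipartite E →
      (∀ e ∈ E, IsPfaffianBipartite (E.erase e)) →
      (∀ i, (E.filter fun c : Fin n × Fin n => c.1 = i).card ≠ 2) →
      (∀ j, (E.filter fun c : Fin n × Fin n => c.2 = j).card ≠ 2) →
      ∃ ρ κ : Perm (Fin n), E = relabel (Finset.univ.filter fun e : Fin n × Fin n =>
        ((e.1 : ℕ) < 3 ∧ (e.2 : ℕ) < 3) ∨ (e.1 = e.2 ∧ 3 ≤ (e.1 : ℕ))) ρ κ :=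
  fun _ hE hmin hrow hcol => exists_relabel_kstd_of_minimal hE hmin hrow hcol

/-- **The E-side chain** (registered stub `stub_chain` of the line `even_induction`). -/
theorem stub_chain : ∀ (n : ℕ) (H E : Finset (Fin n × Fin n)) (φ : Fin n × Fin n → Fin n × Fin n),
    (∑ σ : Perm (Fin n), if (∀ i, (i, σ i) ∈ H) then
        ∏ i, (X (φ (i, σ i)) : MvPolynomial (Fin n × Fin n) ℂ) else 0) = perfectMatchingPoly E ℂ →
    ¬ IsPfaffianBipartite E →
    ∃ (H₁ : Finset (Fin n × Fin n)) (φ₁ : Fin n × Fin n → Fin n × Fin n) (ρ κ : Perm (Fin n)),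
      H₁ ⊆ H ∧
      (∑ σ : Perm (Fin n), if (∀ i, (i, σ i) ∈ H₁) then
          ∏ i, (X (φ₁ (i, σ i)) : MvPolynomial (Fin n × Fin n) ℂ) else 0) =
        perfectMatchingPoly (relabel (Finset.univ.filter fun e : Fin n × Fin n =>
          ((e.1 : ℕ) < 3 ∧ (e.2 : ℕ) < 3) ∨ (e.1 = e.2 ∧ 3 ≤ (e.1 : ℕ))) ρ κ) ℂ :=
  fun _ => labelIdentity_chain_of spec_fold spec_noParallel spec_transpose spec_base

/-- **`SignedCoverLittle` holds**: Pólya's problem at equal size in the cover model — if `PM_E` is a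
projection of `PM_{E'}` for a Pfaffian `E'` of the same size, then `E` is Pfaffian. [this port] -/
theorem signedCoverLittle_proof :
    Summit.ValiantsHypothesis.ValiantsHypothesis.Theses.PolyaContinued.SignedCoverLittle :=
  signedCoverLittle_of_chain stub_chain

end Summit.ValiantsHypothesis.PolyaContinued
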